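import Mathlib
import Literature.AlgebraicGeometry.Ramification.InertiaNormalSylow
import HarnessLib

/-!
# Inertia-type actions on a discrete valuation ring are p-closed (Serre, *Corps locaux* IV §2, Cor. 4 — any residue field)

Companion of `InertiaNormalSylow.lean` (Abbes–Saito's property (NpS): inertia groups with a
normal Sylow `p`-subgroup). The classical source of (NpS) **in codimension one**: a finite group
`I` acting faithfully by ring automorphisms on a discrete valuation ring `A` of characteristic `p`,
trivially on the residue field (an "inertia-type" action — exactly the inertia group of a point
of codimension `1` of a regular scheme with a group action, AS2011 2.4), has a normal Sylow
`p`-subgroup: the kernel of `θ : I → κ(A)ˣ, g ↦ g(ϖ)/ϖ mod 𝔪` is a `p`-group and `I/ker θ`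
embeds in `κ(A)ˣ`, whose finite subgroups have order prime to `p`.

The textbook proof (Serre IV §2 Prop. 7 / Cor. 4) uses the lower ramification filtration and
needs the extension to be monogenic (separable residue field extension). The statement itself
holds for EVERY residue field — imperfect ones included, as the programme's barrier
`InseparableBaseChange` demands — by an averaging argument which we formalise here: an element
`h ∈ ker θ` of order `m` prime to `p` satisfies `h(a) - a ∈ 𝔪ⁿ⁺¹` for `a ∈ 𝔪ⁿ` ("`h` is the
identity on `gr A`"), and the Reynolds operator `e(a) = m⁻¹ ∑ hʲ(a)` (`m` is invertible in the
`𝔽_p`-algebra `A`) produces `h`-invariants with `e(a) - a` one level deeper, so by induction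
`h(a) - a ∈ 𝔪ⁿ` for all `n`, i.e. `h = 1` (Krull); hence every element of `ker θ` has `p`-power
order.

* `hasNormalSylow_of_faithful_residueTrivial_action` — the theorem.
* helpers: `ringEquiv_apply_mem_maximalIdeal_pow` (automorphisms preserve `𝔪ⁿ`),
  `exists_unit_mul_eq_apply_uniformizer` (`g ϖ = u ϖ`), `apply_sub_self_mem_pow_succ`
  (identity on `gr A` for `g ∈ ker θ`), `eq_one_of_residueTrivial_of_isUnit_orderOf` (the averaging step).
-/

namespace Literature.AlgebraicGeometry.Ramification

open IsLocalRing

section DVR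

variable {A : Type*} [CommRing A] [IsDomain A] [IsDiscreteValuationRing A]

/-- A ring automorphism of a local ring maps the maximal ideal into itself. [folklore] -/
theorem ringEquiv_apply_mem_maximalIdeal (φ : A ≃+* A) {a : A} (ha : a ∈ maximalIdeal A) :
    φ a ∈ maximalIdeal A := by
  rw [mem_maximalIdeal, mem_nonunits_iff] at ha ⊢
  intro hu
  exact ha (by simpa using hu.map φ.symm)

/-- A ring automorphism of a local ring maps every power of the maximal ideal into itself.
[folklore] -/
theorem ringEquiv_apply_mem_maximalIdeal_pow (φ : A ≃+* A) (n : ℕ) {a : A}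
    (ha : a ∈ maximalIdeal A ^ n) : φ a ∈ maximalIdeal A ^ n := by
  have h : Ideal.map (φ : A →+* A) (maximalIdeal A ^ n) ≤ maximalIdeal A ^ n := by
    rw [Ideal.map_pow]
    refine Ideal.pow_right_mono ?_ n
    rw [Ideal.map_le_iff_le_comap]
    intro x hx
    exact ringEquiv_apply_mem_maximalIdeal φ hx
  exact h (Ideal.mem_map_of_mem _ ha)

/-- In a discrete valuation ring with uniformizer `ϖ`, an automorphism multiplies `ϖ` by a unit:
`φ ϖ = u ϖ`. [folklore] -/
theorem exists_unit_mul_eq_apply_uniformizer (φ : A ≃+* A) {ϖ : A} (hϖ : Irreducible ϖ) :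
    ∃ u : A, IsUnit u ∧ φ ϖ = u * ϖ := by
  have hmem : φ ϖ ∈ maximalIdeal A :=
    ringEquiv_apply_mem_maximalIdeal φ (hϖ.maximalIdeal_eq ▸ Ideal.mem_span_singleton_self ϖ)
  rw [hϖ.maximalIdeal_eq, Ideal.mem_span_singleton'] at hmem
  obtain ⟨u, hu⟩ := hmem
  refine ⟨u, ?_, hu.symm⟩
  have hirr : Irreducible (φ ϖ) := hϖ.map φ
  rw [← hu] at hirr
  exact (hirr.isUnit_or_isUnit rfl).resolve_right hϖ.not_isUnit

/-- **Identity on `gr A`.** If the automorphism `φ` acts trivially on the residue field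
(`φ a - a ∈ 𝔪` for all `a`) and `φ ϖ = u ϖ` with `u ≡ 1 (mod 𝔪)`, then `φ a - a ∈ 𝔪ⁿ⁺¹` for every
`a ∈ 𝔪ⁿ`. [cite: Serre1979, Ch. IV §2 Prop. 7 (proof)] -/
theorem apply_sub_self_mem_pow_succ (φ : A ≃+* A) (hres : ∀ a : A, φ a - a ∈ maximalIdeal A)
    {ϖ u : A} (hϖ : Irreducible ϖ) (hu : φ ϖ = u * ϖ) (hu1 : u - 1 ∈ maximalIdeal A)
    (n : ℕ) {a : A} (ha : a ∈ maximalIdeal A ^ n) :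
    φ a - a ∈ maximalIdeal A ^ (n + 1) := by
  rw [hϖ.maximalIdeal_eq, Ideal.span_singleton_pow, Ideal.mem_span_singleton'] at ha
  obtain ⟨b, rfl⟩ := ha
  have key : φ (b * ϖ ^ n) - b * ϖ ^ n = (φ b * u ^ n - b) * ϖ ^ n := by
    rw [map_mul, map_pow, hu, mul_pow]; ring
  rw [key, pow_succ', ]
  refine Ideal.mul_mem_mul ?_ ?_
  · -- `φ b * u ^ n - b ∈ 𝔪`: residues `b̄ · 1 - b̄ = 0`
    have h1 : φ b * u ^ n - b = (φ b - b) * u ^ n + b * (u ^ n - 1) := by ring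
    rw [h1]
    refine Ideal.add_mem _ (Ideal.mul_mem_right _ _ (hres b)) (Ideal.mul_mem_left _ _ ?_)
    have h2 : u ^ n - 1 = (u - 1) * (Finset.range n).sum (fun i => u ^ i) := by
      rw [mul_comm, ← geom_sum_mul]
    rw [h2]
    exact Ideal.mul_mem_right _ _ hu1
  · rw [hϖ.maximalIdeal_eq, Ideal.span_singleton_pow]
    exact Ideal.mem_span_singleton_self _

/-- **The averaging step.** Let `φ` be an automorphism of finite order `m` with `m` a unit in
`A`, acting trivially on the residue field and with `φ ϖ = u ϖ`, `u ≡ 1 (mod 𝔪)`. Then `φ = 1`: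
by `apply_sub_self_mem_pow_succ`, `φ` is the identity on `gr A`; the Reynolds operator
`e(a) = m⁻¹ ∑_{j<m} φʲ(a)` is `φ`-invariant with `a - e(a) ∈ 𝔪ⁿ` whenever `φ ≡ 1 (mod 𝔪ⁿ)`, so
`φ a - a = φ(a - e a) - (a - e a) ∈ 𝔪ⁿ⁺¹`; by induction `φ a - a ∈ ⋂ 𝔪ⁿ = 0`. [folklore] -/
theorem eq_one_of_residueTrivial_of_isUnit_orderOf (φ : A ≃+* A)
    (hres : ∀ a : A, φ a - a ∈ maximalIdeal A) {ϖ u : A} (hϖ : Irreducible ϖ)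
    (hu : φ ϖ = u * ϖ) (hu1 : u - 1 ∈ maximalIdeal A) (hm : IsUnit ((orderOf φ : ℕ) : A))
    (_hfin : 0 < orderOf φ) : φ = 1 := by
  set m := orderOf φ with hmdef
  obtain ⟨mi, hmi⟩ := hm.exists_left_inv
  -- the Reynolds operator
  let e : A → A := fun a => mi * (Finset.range m).sum fun j => (φ ^ j) a
  have he_inv : ∀ a, φ (e a) = e a := by
    intro a
    simp only [e, map_mul, map_sum]
    have hmi' : φ mi = mi := by
      -- `mi` is the inverse of the natural number `m`, fixed by `φ`
      have h1 : φ mi * (m : A) = 1 := by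
        have := congrArg φ hmi
        rwa [map_mul, map_natCast, map_one] at this
      calc φ mi = φ mi * ((m : A) * mi) := by rw [mul_comm (m : A) mi, hmi, mul_one]
        _ = (φ mi * (m : A)) * mi := by ring
        _ = mi := by rw [h1, one_mul]
    rw [hmi']
    congr 1
    have hshift : ∀ j, φ ((φ ^ j) a) = (φ ^ (j + 1)) a := fun j => by
      rw [pow_succ', RingAut.mul_apply]
    simp_rw [hshift]
    have hperiod : (φ ^ m) a = (φ ^ 0) a := by rw [pow_orderOf_eq_one, pow_zero]
    have := Finset.sum_range_succ_comm (fun j => (φ ^ j) a) m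
    -- `∑_{j<m+1} f j = f m + ∑_{j<m} f j` and `∑_{j<m+1} f j = ∑_{j<m} f (j+1) + f 0`
    rw [Finset.sum_range_succ'] at this
    rw [hperiod, add_comm ((φ ^ 0) a)] at this
    exact add_right_cancel this
  have he_sub : ∀ n : ℕ, (∀ a, φ a - a ∈ maximalIdeal A ^ n) →
      ∀ a, a - e a ∈ maximalIdeal A ^ n := by
    intro n hn a
    have hpow : ∀ j : ℕ, (φ ^ j) a - a ∈ maximalIdeal A ^ n := by
      intro j
      induction j with
      | zero => simp
      | succ j ih =>
        have : (φ ^ (j + 1)) a - a = (φ ((φ ^ j) a) - (φ ^ j) a) + ((φ ^ j) a - a) := by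
          rw [pow_succ', RingAut.mul_apply]; ring
        rw [this]
        exact Ideal.add_mem _ (hn _) ih
    have hrepr : a - e a = mi * (Finset.range m).sum (fun j => a - (φ ^ j) a) := by
      simp only [e, Finset.sum_sub_distrib, Finset.sum_const, Finset.card_range, nsmul_eq_mul,
        mul_sub]
      rw [← mul_assoc, hmi, one_mul]
    rw [hrepr]
    refine Ideal.mul_mem_left _ _ (Ideal.sum_mem _ fun j _ => ?_)
    rw [← neg_sub]
    exact Submodule.neg_mem _ (hpow j)
  -- induction on the level
  have hlevel : ∀ n : ℕ, ∀ a, φ a - a ∈ maximalIdeal A ^ n := by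
    intro n
    induction n with
    | zero => intro a; simp
    | succ n ih =>
      intro a
      have hc : a - e a ∈ maximalIdeal A ^ n := he_sub n ih a
      have hdecomp : φ a - a = φ (a - e a) - (a - e a) := by
        rw [map_sub, he_inv]; ring
      rw [hdecomp]
      exact apply_sub_self_mem_pow_succ φ hres hϖ hu hu1 n hc
  -- Krull intersection
  apply RingEquiv.ext
  intro a
  have hmem : φ a - a ∈ (⨅ n : ℕ, maximalIdeal A ^ n) := Ideal.mem_iInf.mpr fun n => hlevel n a
  rw [Ideal.iInf_pow_eq_bot_of_isLocalRing _ (maximalIdeal.isMaximal A).ne_top,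
    Ideal.mem_bot, sub_eq_zero] at hmem
  simpa using hmem

/-- **Inertia-type actions on a discrete valuation ring are p-closed** (Serre, *Corps locaux*
IV §2, Cor. 4, for an arbitrary residue field): let `A` be a discrete valuation ring of
characteristic `p` and `I` a finite group acting FAITHFULLY on `A` by ring automorphisms which
induce the identity on the residue field (`g a - a ∈ 𝔪`). Then `I` has a normal Sylow
`p`-subgroup — the kernel of `θ : g ↦ g(ϖ)/ϖ mod 𝔪`, a `p`-group (an element of `ker θ` of order
prime to `p` is trivial by `eq_one_of_residueTrivial_of_isUnit_orderOf`), of index prime to `p`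
(`I/ker θ ↪ κ(A)ˣ` and `x ^ p = 1 ⇒ x = 1` in characteristic `p`). This is property (NpS) at
points of codimension one. [cite: Serre1979, Ch. IV §2 Cor. 4] -/
theorem hasNormalSylow_of_faithful_residueTrivial_action (p : ℕ) [Fact p.Prime] [CharP A p]
    {I : Type*} [Group I] [Finite I] (σ : I →* (A ≃+* A)) (hσ : Function.Injective σ)
    (hres : ∀ (g : I) (a : A), σ g a - a ∈ maximalIdeal A) : HasNormalSylow p I := by
  classical
  obtain ⟨ϖ, hϖ⟩ := IsDiscreteValuationRing.exists_irreducible A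
  have hϖ0 : ϖ ≠ 0 := hϖ.ne_zero
  -- the unit `u g` with `g ϖ = u g * ϖ`
  choose u hu using fun g : I => exists_unit_mul_eq_apply_uniformizer (σ g) hϖ
  have hu_one : u 1 = 1 := by
    have h := (hu 1).2
    rw [map_one, RingAut.one_apply] at h
    exact mul_left_injective₀ hϖ0 (h.symm.trans (one_mul ϖ).symm)
  have hu_mul : ∀ g h : I, u (g * h) = σ g (u h) * u g := by
    intro g h
    have e1 := (hu (g * h)).2
    rw [map_mul, RingAut.mul_apply, (hu h).2, map_mul, (hu g).2, ← mul_assoc] at e1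
    exact mul_left_injective₀ hϖ0 e1.symm
  -- the character `θ : I →* κ(A)`, `g ↦ u g mod 𝔪`
  have hres' : ∀ (g : I) (a : A), residue A (σ g a) = residue A a := fun g a => by
    rw [← sub_eq_zero, ← map_sub, residue_eq_zero_iff]; exact hres g a
  have hu_ne : ∀ g : I, residue A (u g) ≠ 0 := fun g h0 =>
    (mem_maximalIdeal _).mp ((residue_eq_zero_iff _).mp h0) (hu g).1
  obtain ⟨θ, hθ⟩ : ∃ θ : I →* (ResidueField A)ˣ, ∀ g, (θ g : ResidueField A) = residue A (u g) :=
    ⟨{ toFun := fun g => Units.mk0 (residue A (u g)) (hu_ne g)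
       map_one' := Units.ext (by simp only [Units.val_mk0, hu_one, map_one, Units.val_one])
       map_mul' := fun g h => Units.ext (by
         simp only [Units.val_mk0, Units.val_mul, hu_mul, map_mul, hres']
         rw [mul_comm]) }, fun g => rfl⟩
  -- (1) the kernel of `θ` is a `p`-group
  have hker : IsPGroup p θ.ker := by
    intro ⟨g, hg⟩
    rw [MonoidHom.mem_ker] at hg
    -- split the order of `g` as `p ^ a * m` with `p ∤ m`
    obtain ⟨a, m, hpm, hord⟩ :=
      Nat.exists_eq_pow_mul_and_not_dvd (orderOf_pos g).ne' p (Fact.out : p.Prime).ne_one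
    refine ⟨a, Subtype.ext ?_⟩
    change g ^ p ^ a = 1
    set h : I := g ^ p ^ a with hhdef
    have hordh : orderOf h = m := by
      rw [hhdef, orderOf_pow' g (pow_ne_zero a (Fact.out : p.Prime).ne_zero), hord,
        Nat.gcd_mul_right_left, Nat.mul_div_cancel_left m (pos_of_ne_zero (pow_ne_zero a
          (Fact.out : p.Prime).ne_zero))]
    -- `h ∈ ker θ`: `u h ≡ 1`
    have hhker : residue A (u h) = 1 := by
      have : θ h = 1 := by rw [hhdef, map_pow, hg, one_pow]
      rw [← hθ, this, Units.val_one]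
    have hu1 : u h - 1 ∈ maximalIdeal A := by
      rw [← residue_eq_zero_iff, map_sub, map_one, hhker, sub_self]
    -- `m` is a unit in the `𝔽_p`-algebra `A`
    have hmunit : IsUnit ((orderOf (σ h) : ℕ) : A) := by
      have hdiv : orderOf (σ h) ∣ m := hordh ▸ orderOf_map_dvd σ h
      have hpm' : ¬ p ∣ orderOf (σ h) := fun hd => hpm (hd.trans hdiv)
      have hz : IsUnit ((orderOf (σ h) : ℕ) : ZMod p) := by
        rw [isUnit_iff_ne_zero, Ne, ZMod.natCast_eq_zero_iff]
        exact hpm'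
      simpa [map_natCast] using hz.map (ZMod.castHom (dvd_refl p) A)
    have hordpos : 0 < orderOf (σ h) := (σ.isOfFinOrder (isOfFinOrder_of_finite h)).orderOf_pos
    have hσh : σ h = 1 :=
      eq_one_of_residueTrivial_of_isUnit_orderOf (σ h) (hres h) hϖ (hu h).2 hu1 hmunit hordpos
    exact hσ (by rw [hσh, map_one])
  -- (2) the index of `ker θ` is prime to `p`: `I/ker θ ↪ κ(A)`, no elements of order `p` there
  have hindex : ¬ p ∣ θ.ker.index := by
    intro hdvd
    have hcard : p ∣ Nat.card (I ⧸ θ.ker) := by rwa [← Subgroup.index_eq_card]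
    obtain ⟨x, hx⟩ := exists_prime_orderOf_dvd_card' (G := I ⧸ θ.ker) p hcard
    -- its image `y` in the field `κ(A)` of characteristic `p` satisfies `y ^ p = 1`, so `y = 1`
    haveI : CharP (ResidueField A) p := by
      refine CharP.quotient' p (maximalIdeal A) fun x hx => ?_
      -- a natural number in `𝔪` is divisible by `p`, hence zero in `A`
      by_contra hne
      have hpx : ¬ p ∣ x := fun hd => hne ((CharP.cast_eq_zero_iff A p x).mpr hd)
      have hux : IsUnit ((x : ℕ) : A) := by
        have hz : IsUnit ((x : ℕ) : ZMod p) := by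
          rw [isUnit_iff_ne_zero, Ne, ZMod.natCast_eq_zero_iff]
          exact hpx
        simpa [map_natCast] using hz.map (ZMod.castHom (dvd_refl p) A)
      exact (mem_maximalIdeal _).mp hx hux
    have hyp : ((QuotientGroup.kerLift θ x : (ResidueField A)ˣ) : ResidueField A) ^ p = 1 := by
      rw [← Units.val_pow_eq_pow_val, ← map_pow, ← hx, pow_orderOf_eq_one, map_one, Units.val_one]
    have hy1 : QuotientGroup.kerLift θ x = 1 := by
      apply Units.ext
      have h := sub_pow_char
        ((QuotientGroup.kerLift θ x : (ResidueField A)ˣ) : ResidueField A) 1 (p := p)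
      rw [hyp, one_pow, sub_self] at h
      rw [Units.val_one]
      exact sub_eq_zero.mp (pow_eq_zero_iff (Fact.out : p.Prime).ne_zero |>.mp h)
    have hx1 : x = 1 := QuotientGroup.kerLift_injective θ (by rw [hy1, map_one])
    rw [hx1, orderOf_one] at hx
    exact (Fact.out : p.Prime).one_lt.ne hx
  exact HasNormalSylow.of_normal_of_not_dvd_index θ.ker hker hindex

end DVR

end Literature.AlgebraicGeometry.Ramification
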